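import Summits.QuantumFields.YangMills.Theorems.BalabanLadderIRTwistedSlabDefs
import Literature.MathematicalPhysics.QuantumFieldTheory.Sweep1ShenZhuZhuProofs
import Literature.MathematicalPhysics.QuantumLattice.TwistedBoundaryConditions
import HarnessLib

/-!
# T1's `∀ G` binder, typed: `TwistedSlabAnchor` ⇐ (isolating twist ⇒ `G ≃ SU(N)`, `z ↦ ω^k` — a NAMED classical hypothesis) ∧
# (T1 TYPED AT `SU(N)` for every faithful `r`), by Haar transport of `projSlabDefect` along a continuous group isomorphism

HELPER toward stub **T1** `TwistedSlabAnchor` of LINE `twisted-slab-continuity` (crux `IRcof`, stmt-QuantumFields-26930, census row 43;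
LEAD prover ym-ir-line-tsc-p1 g6; `--supports` the crux, `--as helper`).  Theorems only.  K41 of the T1 programme — the `∀ G` binder of
the stub (memo `Cruxes/IRcof/T1-ANATOMY-tsc-p1.md` §16.2; crit-3 g6 l.1829 (4): «be clear it MOVES the BFM debt, it does not retire it»):

* §1 TRANSPORT (every pair of compact Borel groups `G, H`, `H` second countable, `e : G ≃* H` continuous, `ρ' : H →* M_n(ℂ)`):
  `finTorusPlaquette_map`, `tHooftTwistTensor_map`, `slabTwist_map`, ★ `wilsonFinTorusPlaqTwistedPartition_transport`
  (`Z^{c}_{ρ'∘e} = Z^{e∘c}_{ρ'}`: the change of variables `U ↦ e ∘ U` in the product Haar integral — the tree's `map_haarProbability_of_mulEquiv` +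
  Mathlib `measurePreserving_pi`, `integral_map`), `wilsonFinTorusTensorTwistedPartition_transport`, ★ `projSlabZ_transport`
  (`projSlabZ (ρ'∘e) β z = projSlabZ ρ' β (e z)`), ★ `projSlabDefect_transport`.
* §2 ★★ `twistedSlabAnchor_of_classification_of_su` — **THE STUB from two hypotheses, both spelled inline (no new `def`)**:
  (hcl) for every compact simple simply-connected `G` and every central `z ≠ 1` with an isolating twist there are `N ≥ 2`, a unit `k : ZMod N` and a
  bi-continuous `e : G ≃* SU(N)` with `e z = ω^k·1` — the classification of compact simple Lie groups + Borel–Friedman–Morgan (almost commuting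
  elements; for type `A` the tree's `IsolatingTwistIffGenerating`), CITED, NOT PROVED, not in Mathlib: a located `∀ G` debt of width 0;
  (hsu) T1 TYPED AT `SU(N)`: for `N ≥ 2`, `k` a unit, `n ≥ 1` with `(ω^k·1)^n = 1` and EVERY `r : LatticeRep SU(N)`,
  `∃ ℓ₀ β₀ c C, 2 ≤ ℓ₀ ∧ 0 < c ∧ ∀ β ≥ β₀ ∀ L ≥ 2 ∀ t ≥ 1, projSlabDefect r.ρ β (ω^k·1) n ℓ₀ L t ≤ C·L·e^{−ct}` — K39's shape with `∃ β₀` BEFORE `∀ L`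
  and a general faithful `r` (= the r-port, director №56, ∘ the transposition M4).
  So `TwistedSlabAnchor` = (hcl) ∧ (hsu) BY NAME; the reshape «type T1 at `SU(N)`» (memo §16.2 R1) costs exactly (hcl) in the composition.

HONEST FRAMING: a change of variables and a composition; (hcl) is an open NAMED hypothesis here (classical and published, but absent from the
tree), (hsu) is open (M4); T1 0∕1; nothing here bears on `IRcof`, `IR`, or the Yang–Mills mass gap (Clay: NOT proved); R4 = `BalabanLadder.UV` only.
References: A. Borel, R. Friedman, J. W. Morgan, *Almost commuting elements in compact Lie groups*, Mem. AMS 747 (2002), Prop. 4.1.1;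
G. 't Hooft, Nucl. Phys. B 153 (1979) §3; A. González-Arroyo, M. Okawa, Phys. Rev. D 27 (1983) 2397.
-/

set_option autoImplicit false

noncomputable section

open MeasureTheory
open scoped BigOperators
open Literature.MathematicalPhysics.QuantumFieldTheory Literature.MathematicalPhysics.QuantumLattice

namespace Summit.QuantumFields.YangMills.Cruxes.IRcof.TwistedSlab

/-! ## §1 Transport along a continuous isomorphism of compact groups -/

section Transport

variable {G H : Type*} [Group G] [Group H] {F : Type*} [FunLike F G H] [MonoidHomClass F G H]

/-- Plaquette holonomies commute with a group homomorphism applied linkwise. [folklore] -/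
theorem finTorusPlaquette_map {a b c d : ℕ} (e : F) (U : FinTorusSite a b c d × Fin 4 → G) (x : FinTorusSite a b c d)
    (μ ν : Fin 4) : finTorusPlaquette (fun l => e (U l)) x μ ν = e (finTorusPlaquette U x μ ν) := by
  unfold finTorusPlaquette
  simp only [map_mul, map_inv]

/-- 't Hooft's stack tensor commutes with a homomorphism applied to the six twists. [cite: tHooft1979Flux, §2 (2.5)–(2.6)] -/
theorem tHooftTwistTensor_map {a b c d : ℕ} (e : F) (w : Fin 4 → Fin 4 → G) (x : FinTorusSite a b c d) (μ ν : Fin 4) :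
    tHooftTwistTensor (fun μ ν => e (w μ ν)) x μ ν = e (tHooftTwistTensor w x μ ν) := by
  unfold tHooftTwistTensor
  split_ifs <;> simp

/-- The slab tensor commutes with a homomorphism. [cite: tHooft1979Flux, §2 (2.5)] -/
theorem slabTwist_map (e : F) (zM zE : G) : slabTwist (e zM) (e zE) = fun μ ν => e (slabTwist zM zE μ ν) := by
  funext μ ν
  unfold slabTwist
  split_ifs <;> simp

variable [TopologicalSpace G] [IsTopologicalGroup G] [CompactSpace G] [MeasurableSpace G] [BorelSpace G]
  [TopologicalSpace H] [IsTopologicalGroup H] [CompactSpace H] [MeasurableSpace H] [BorelSpace H] [SecondCountableTopology H]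
  {n : ℕ}

/-- ★ **Transport of the plaquette-twisted Wilson integral along a continuous isomorphism of compact groups**:
`Z^{c}_{ρ'∘e}(a,b,c,d) = Z^{e∘c}_{ρ'}(a,b,c,d)` — the change of variables `U ↦ e ∘ U` (Haar product measure is transported: the tree's
`map_haarProbability_of_mulEquiv`, Mathlib `measurePreserving_pi`). [cite: tHooft1979Flux, §2 (2.6)] -/
theorem wilsonFinTorusPlaqTwistedPartition_transport (e : G ≃* H) (he : Continuous e) (ρ' : H →* Matrix (Fin n) (Fin n) ℂ)
    (hρ' : Continuous ρ') (β : ℝ) (a b c d : ℕ) (tw : FinTorusSite a b c d → Fin 4 → Fin 4 → G) :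
    wilsonFinTorusPlaqTwistedPartition (ρ'.comp e.toMonoidHom) β a b c d tw =
      wilsonFinTorusPlaqTwistedPartition ρ' β a b c d (fun x μ ν => e (tw x μ ν)) := by
  have hE : MeasurePreserving (fun (U : FinTorusSite a b c d × Fin 4 → G) (l : FinTorusSite a b c d × Fin 4) => e (U l))
      (Measure.pi fun _ : FinTorusSite a b c d × Fin 4 => haarProbability G)
      (Measure.pi fun _ : FinTorusSite a b c d × Fin 4 => haarProbability H) :=
    measurePreserving_pi (fun _ : FinTorusSite a b c d × Fin 4 => haarProbability G)
      (fun _ : FinTorusSite a b c d × Fin 4 => haarProbability H)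
      (fun _ => ⟨he.measurable, map_haarProbability_of_mulEquiv e he⟩)
  unfold wilsonFinTorusPlaqTwistedPartition
  rw [← hE.map_eq, integral_map hE.measurable.aemeasurable
    ((continuous_finTorusPlaqTwistedWeight ρ' hρ' β (fun x μ ν => e (tw x μ ν))).aestronglyMeasurable)]
  refine integral_congr_ae (ae_of_all _ fun U => ?_)
  simp only [MonoidHom.coe_comp, Function.comp_apply, MulEquiv.coe_toMonoidHom, finTorusPlaquette_map, map_mul]

/-- Transport of 't Hooft's tensor-twisted functional integral: `W{w}_{ρ'∘e} = W{e∘w}_{ρ'}`. [cite: tHooft1979Flux, §2 (2.6)] -/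
theorem wilsonFinTorusTensorTwistedPartition_transport (e : G ≃* H) (he : Continuous e) (ρ' : H →* Matrix (Fin n) (Fin n) ℂ)
    (hρ' : Continuous ρ') (β : ℝ) (w : Fin 4 → Fin 4 → G) (a b c d : ℕ) :
    wilsonFinTorusTensorTwistedPartition (ρ'.comp e.toMonoidHom) β w a b c d =
      wilsonFinTorusTensorTwistedPartition ρ' β (fun μ ν => e (w μ ν)) a b c d := by
  rw [wilsonFinTorusTensorTwistedPartition_def, wilsonFinTorusTensorTwistedPartition_def,
    wilsonFinTorusPlaqTwistedPartition_transport e he ρ' hρ']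
  congr 1
  funext x μ ν
  exact (tHooftTwistTensor_map e w x μ ν).symm

/-- ★ **Transport of the e-flux-projected twisted slab**: `projSlabZ (ρ'∘e) β z n ℓ L t = projSlabZ ρ' β (e z) n ℓ L t`.
[cite: tHooft1979Flux, §5 (5.2)–(5.4)] -/
theorem projSlabZ_transport (e : G ≃* H) (he : Continuous e) (ρ' : H →* Matrix (Fin n) (Fin n) ℂ) (hρ' : Continuous ρ')
    (β : ℝ) (z : G) (m ℓ L t : ℕ) :
    projSlabZ (ρ'.comp e.toMonoidHom) β z m ℓ L t = projSlabZ ρ' β (e z) m ℓ L t := by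
  unfold projSlabZ
  congr 1
  refine Finset.sum_congr rfl fun k _ => ?_
  rw [wilsonFinTorusTensorTwistedPartition_transport e he ρ' hρ', ← map_pow, slabTwist_map e z (z ^ (k : ℕ))]

/-- ★ **Transport of the purity defect**: `projSlabDefect (ρ'∘e) β z n ℓ L t = projSlabDefect ρ' β (e z) n ℓ L t`.
[cite: tHooft1979Flux, §5 (5.1)–(5.4)] -/
theorem projSlabDefect_transport (e : G ≃* H) (he : Continuous e) (ρ' : H →* Matrix (Fin n) (Fin n) ℂ) (hρ' : Continuous ρ')
    (β : ℝ) (z : G) (m ℓ L t : ℕ) :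
    projSlabDefect (ρ'.comp e.toMonoidHom) β z m ℓ L t = projSlabDefect ρ' β (e z) m ℓ L t := by
  unfold projSlabDefect
  rw [projSlabZ_transport e he ρ' hρ', projSlabZ_transport e he ρ' hρ']

end Transport

/-! ## §2 The stub from (classification) ∧ (T1 typed at `SU(N)`) -/

/-- ★★ **`TwistedSlabAnchor` ⇐ (isolating twist ⇒ `G ≃ SU(N)`, `z ↦ ω^k·1`) ∧ (T1 TYPED AT `SU(N)` for every faithful `r`).**
(hcl) is the classification of compact simple simply-connected Lie groups carrying an isolating central twist (Borel–Friedman–Morgan +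
the classification; type `A`: the tree's `IsolatingTwistIffGenerating`) — a NAMED HYPOTHESIS here, cited not proved; (hsu) is the stub re-typed
at `G = SU(N)`, `z = ω^k·1` with `∃ β₀` BEFORE `∀ L` (open: the r-port ∘ the transposition M4).  Proof: read `r` on `SU(N)` through `e.symm`
(a faithful continuous unitary representation of `SU(N)`), apply (hsu), pull the bound back by `projSlabDefect_transport`. [cite: tHooft1979Flux, §3 and §5 (5.1)–(5.4)] -/
theorem twistedSlabAnchor_of_classification_of_su
    (hcl : ∀ (G : Type) [Group G] [TopologicalSpace G] [IsTopologicalGroup G] [CompactSpace G],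
      IsCompactSimpleLieGroup G → SimplyConnectedSpace G →
      ∀ z : G, z ∈ Subgroup.center G → z ≠ 1 → HasIsolatingTwist G z →
        ∃ (N : ℕ) (k : ZMod N) (e : G ≃* Matrix.specialUnitaryGroup (Fin N) ℂ),
          2 ≤ N ∧ IsUnit k ∧ Continuous e ∧ Continuous e.symm ∧
            e z = (suCenter N k : Matrix.specialUnitaryGroup (Fin N) ℂ))
    (hsu : ∀ (N : ℕ) (k : ZMod N), 2 ≤ N → IsUnit k → ∀ n : ℕ, 0 < n →
      (suCenter N k : Matrix.specialUnitaryGroup (Fin N) ℂ) ^ n = 1 →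
      ∀ r : LatticeRep (Matrix.specialUnitaryGroup (Fin N) ℂ), ∃ (ℓ₀ : ℕ) (β₀ c C : ℝ), 2 ≤ ℓ₀ ∧ 0 < c ∧
        ∀ β : ℝ, β₀ ≤ β → ∀ L t : ℕ, 2 ≤ L → 1 ≤ t →
          projSlabDefect r.ρ β (suCenter N k : Matrix.specialUnitaryGroup (Fin N) ℂ) n ℓ₀ L t ≤
            C * (L : ℝ) * Real.exp (-(c * (t : ℝ)))) :
    TwistedSlabAnchor := by
  intro G _ _ _ _ hG hsc
  letI : MeasurableSpace G := borel G
  haveI : BorelSpace G := ⟨rfl⟩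
  intro z n hz hz1 hn hzn hiso r
  obtain ⟨N, k, e, hN, hk, he, he', hez⟩ := hcl G hG hsc z hz hz1 hiso
  -- `(ω^k·1)^n = 1` from `z^n = 1`
  have hzn' : (suCenter N k : Matrix.specialUnitaryGroup (Fin N) ℂ) ^ n = 1 := by
    rw [← hez, ← map_pow, hzn, map_one]
  -- the representation read on `SU(N)` through `e⁻¹`: faithful, continuous, unitary
  let r' : LatticeRep (Matrix.specialUnitaryGroup (Fin N) ℂ) :=
    ⟨r.N, r.ρ.comp e.symm.toMonoidHom, r.continuous.comp he', r.injective.comp e.symm.injective,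
      fun h => r.mem_unitary (e.symm h)⟩
  have hr' : r'.ρ.comp e.toMonoidHom = r.ρ := by
    ext g : 1
    show r.ρ (e.symm (e g)) = r.ρ g
    rw [MulEquiv.symm_apply_apply]
  -- T1 at `SU(N)` for `r'`
  obtain ⟨ℓ₀, β₀, c, C, hℓ₀, hc, hbound⟩ := hsu N k hN hk n hn hzn' r'
  refine ⟨ℓ₀, β₀, c, C, hℓ₀, hc, fun β hβ L t hL ht => ?_⟩
  have h1 : projSlabDefect (r'.ρ.comp e.toMonoidHom) β z n ℓ₀ L t = projSlabDefect r.ρ β z n ℓ₀ L t :=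
    congrArg (fun ρ₀ : G →* Matrix (Fin r.N) (Fin r.N) ℂ => projSlabDefect ρ₀ β z n ℓ₀ L t) hr'
  have h2 := projSlabDefect_transport e he r'.ρ r'.continuous β z n ℓ₀ L t
  calc projSlabDefect r.ρ β z n ℓ₀ L t
      = projSlabDefect (r'.ρ.comp e.toMonoidHom) β z n ℓ₀ L t := h1.symm
    _ = projSlabDefect r'.ρ β (e z) n ℓ₀ L t := h2
    _ ≤ C * (L : ℝ) * Real.exp (-(c * (t : ℝ))) := by
        rw [hez]
        exact hbound β hβ L t hL ht

end Summit.QuantumFields.YangMills.Cruxes.IRcof.TwistedSlab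

end
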